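import Literature.Probability.LatticeModels.CellGridSaddlePercolation
import Literature.Probability.Percolation.TriHexExclusive
import HarnessLib

/-!
# The Hex lemma for the cell grid with saddle coins: `cellCrossing_duality` holds

Topic `Literature/Probability/LatticeModels`. This file discharges the named fact
`Literature.Probability.LatticeModels.cellCrossing_duality` of `CellGridSaddlePercolation.lean`
(Kesten 1982, §2.4 Prop. 2.2 applied to the self-matching pair `(T_κ, T_κ)` of §2.2 Ex. (iii);
Gale 1979, the Hex theorem): for every colouring `σ` of the cells of `ℤ²`, every choice of saddle
coins `κ` and every box `[0, m] × [0, n]`, **exactly one** of the events "black left–right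
crossing of the box in `blackGraph (σ, κ)`" (`cellLRCrossing m n`) and "white top–bottom crossing
of the box in `whiteGraph (σ, κ)`" (`cellTBCrossingWhite m n`) occurs
(`cellCrossing_duality_holds`).

## Proof: a doubling map into the triangular lattice

Kesten's proof (Prop. 2.2, via the planar separation results of his Appendix) and Gale's are
planar topology. We do not redo it: the tree already has both halves of the Hex lemma for site
percolation on the triangular lattice `𝕋 = triGraph` (`ℤ²` plus the diagonals `(1,-1)`) in every
lattice parallelogram `R(m, n) = [0, m] × [0, n]` and for every colouring — `tri_hex`
(`TriHexLemma.lean`, existence, the game of Y has a winner) and `tri_hex_excl`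
(`TriHexExclusive.lean`, exclusivity) — and the triangulation `T_κ = cellGraph κ` (one
coin-selected diagonal per face of `ℤ²`), although not a sub-triangulation of `𝕋`, **embeds into
`𝕋` at scale `2`** together with its colourings. Every site `z` of the refined lattice `ℤ²` gets
an *owner cell* `cellDoubleOwner κ z`: writing `z = 2x + r`,

* the cell site `2x` and the vertical edge-midpoint `2x + e₁` are owned by `x`,
* the horizontal edge-midpoint `2x + e₀` is owned by `x + e₀`,
* the face centre `2x + e₀ + e₁` is owned by `x` if `κ x = true` (the coin joins the NE–SW pair
  `x ∼ x + (1,1)`) and by `x + e₁` if `κ x = false` (the coin joins the NW–SE pair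
  `x + e₁ ∼ x + e₀`),

and is coloured by the colour of its owner (the colouring `cellDoubleOwner κ ⁻¹' black` of `𝕋`;
since the owner map depends on the coins only, colour swap of the cells is complementation of
this colouring, `compl_preimage_cellDoubleOwner_black`). Two elementary facts, checked direction
by direction in coordinates, make this an exact dictionary for paths of *both* colours:

* `cellDoubleOwner_rel` (**projection**): if `z ∼ z'` in `𝕋` then their owners are equal or
  adjacent in `T_κ` (twelve cases; e.g. the face centre `2x + e₀ + e₁` is `𝕋`-adjacent exactly to
  the four midpoints of its face and to the cells `2(x + e₁)`, `2(x + e₀)` of its NW–SE pair, and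
  its owner `x` or `x + e₁` is `T_κ`-adjacent to all their owners thanks to the diagonal selected
  by `κ x`). Hence a monochromatic `𝕋`-path in the doubled box `R(2m, 2n)` projects to a
  monochromatic `T_κ`-path of cells in `R(m, n)` (`pathIn_cellDoubleOwner`), sides to sides.
* `pathIn_two_nsmul` (**lift**): a monochromatic `T_κ`-path of cells `x₀ ∼ x₁ ∼ ⋯` in `R(m, n)`
  lifts to the monochromatic `𝕋`-path `2x₀ ⇝ 2x₁ ⇝ ⋯` in `R(2m, 2n)` passing between `2x` and
  `2y` through the midpoint of the edge `{x, y}`, resp. through `2x + e₁, 2x + e₀ + e₁,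
  2x + e₀ + 2e₁` for the diagonal `y = x + (1,1)` (`κ x = true`), resp. through the face centre
  `2x + (1,-1)` for the diagonal `y = x + (1,-1)` (`κ (x - e₁) = false`).

Then existence is `tri_hex` in `R(2m, 2n)` projected, and exclusivity is `tri_hex_excl` in
`R(2m, 2n)` applied to the lifts of a black left–right and a white top–bottom crossing. The
hypothesis `1 ≤ n` of the fact is not used (the statement also holds for degenerate boxes).

## References

* H. Kesten, *Percolation theory for mathematicians*, Birkhäuser 1982, §2.2 Ex. (iii)
  (a mosaic with only triangular faces is self-matching), §2.4 Prop. 2.2 [Kesten1982].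
* D. Gale, The game of Hex and the Brouwer fixed-point theorem, *Amer. Math. Monthly* 86 (1979)
  818–827 (Hex theorem) [Gale1979].
* B. Bollobás, O. Riordan, *Percolation*, CUP 2006, Ch. 5, Lemma 7 (Hex lemma in a rhombus of
  `𝕋`, the input `tri_hex` / `tri_hex_excl`) [BollobasRiordan2006].

## Mathlib / tree anchors

Mathlib: `Relation.ReflTransGen`, `Fin 2` vectors `![a, b]`, `Int` Euclidean division, `omega`.
Tree: `cellGraph`, `cellDiagRel`, `cellGraph_adj_iff`, `cellGraph_adj_diag_iff`,
`cellGraph_adj_antidiag_iff`, `CellConfig.swap`, `cellLRCrossing`, `cellTBCrossingWhite`,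
`mem_cellConnIn_iff_pathIn` (`CellGridSaddlePercolation.lean`); `triGraph`, `triDiag`
(`TriangularLattice.lean`); `rectangle`, `leftSide`, … (`Crossings.lean`); `PathIn`
(`SitePaths.lean`); `triE0`, `triE1`, `tri_hex` (`TriHexLemma.lean`), `tri_hex_excl`
(`TriHexExclusive.lean`). No new named fact is introduced; the only new definition is the proof
device `cellDoubleOwner`.
-/

namespace Literature.Probability.LatticeModels

open Percolation

/-! ### Coordinates on `ℤ²` -/

/-- Coordinates of `2 • x`. [folklore] -/
theorem two_nsmul_apply (x : Site 2) (i : Fin 2) : (2 • x) i = 2 * x i := by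
  rw [two_nsmul, Pi.add_apply, two_mul]

/-! ### The doubling map: owner cells of the sites of `ℤ²` at scale `2` -/

/-- **Owner cell** of a site `z` of the refined lattice `ℤ²` (scale `2`) for the coins `κ`: writing
`z = 2x + r` with `r ∈ {0, e₀, e₁, e₀ + e₁}`, the cell `2x` and the vertical edge-midpoint
`2x + e₁` are owned by `x`, the horizontal edge-midpoint `2x + e₀` by `x + e₀`, and the face
centre `2x + e₀ + e₁` by `x` if `κ x = true` (the coin joins `x ∼ x + (1,1)`) and by `x + e₁`
otherwise (the coin joins `x + e₁ ∼ x + e₀`). Colouring every refined site by the colour of its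
owner embeds site percolation on the triangulation `cellGraph κ` into site percolation on the
triangular lattice `triGraph` (proof device for `cellCrossing_duality_holds`). [folklore] -/
def cellDoubleOwner (κ : Site 2 → Bool) (z : Site 2) : Site 2 :=
  if z 0 % 2 = 0 then ![z 0 / 2, z 1 / 2]
  else if z 1 % 2 = 0 then ![z 0 / 2 + 1, z 1 / 2]
  else if κ ![z 0 / 2, z 1 / 2] = true then ![z 0 / 2, z 1 / 2] else ![z 0 / 2, z 1 / 2 + 1]

section Owner

variable (κ : Site 2 → Bool) (x : Site 2)

/-- Halving the coordinates of `2x` gives `x`. [folklore] -/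
private theorem half_two_nsmul : (![(2 • x) 0 / 2, (2 • x) 1 / 2] : Site 2) = x := by
  rw [funext_iff, Fin.forall_fin_two]
  simp only [Matrix.cons_val_zero, Matrix.cons_val_one, two_nsmul_apply]
  omega

/-- Halving the coordinates of `2x + e₀` (rounding down) gives `x`. [folklore] -/
private theorem half_two_nsmul_add_triE0 :
    (![(2 • x + triE0) 0 / 2, (2 • x + triE0) 1 / 2] : Site 2) = x := by
  rw [funext_iff, Fin.forall_fin_two]
  simp only [Matrix.cons_val_zero, Matrix.cons_val_one, two_nsmul_apply,
    Pi.add_apply, triE0_apply_zero, triE0_apply_one]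
  omega

/-- Halving the coordinates of `2x + e₁` (rounding down) gives `x`. [folklore] -/
private theorem half_two_nsmul_add_triE1 :
    (![(2 • x + triE1) 0 / 2, (2 • x + triE1) 1 / 2] : Site 2) = x := by
  rw [funext_iff, Fin.forall_fin_two]
  simp only [Matrix.cons_val_zero, Matrix.cons_val_one, two_nsmul_apply,
    Pi.add_apply, triE1_apply_zero, triE1_apply_one]
  omega

/-- Halving the coordinates of `2x + e₀ + e₁` (rounding down) gives `x`. [folklore] -/
private theorem half_two_nsmul_add_triE0_add_triE1 :
    (![(2 • x + triE0 + triE1) 0 / 2, (2 • x + triE0 + triE1) 1 / 2] : Site 2) = x := by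
  rw [funext_iff, Fin.forall_fin_two]
  simp only [Matrix.cons_val_zero, Matrix.cons_val_one, two_nsmul_apply,
    Pi.add_apply, triE0_apply_zero, triE0_apply_one, triE1_apply_zero, triE1_apply_one]
  omega

/-- The cell `2x` is owned by `x`. [folklore] -/
@[simp] theorem cellDoubleOwner_two_nsmul : cellDoubleOwner κ (2 • x) = x := by
  have h0 : (2 • x) 0 % 2 = 0 := by rw [two_nsmul_apply]; omega
  rw [cellDoubleOwner, if_pos h0, half_two_nsmul]

/-- The horizontal edge-midpoint `2x + e₀` is owned by `x + e₀`. [folklore] -/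
@[simp] theorem cellDoubleOwner_two_nsmul_add_triE0 :
    cellDoubleOwner κ (2 • x + triE0) = x + triE0 := by
  have h0 : ¬ (2 • x + triE0) 0 % 2 = 0 := by
    rw [Pi.add_apply, two_nsmul_apply, triE0_apply_zero]; omega
  have h1 : (2 • x + triE0) 1 % 2 = 0 := by
    rw [Pi.add_apply, two_nsmul_apply, triE0_apply_one]; omega
  rw [cellDoubleOwner, if_neg h0, if_pos h1, funext_iff, Fin.forall_fin_two]
  simp only [Matrix.cons_val_zero, Matrix.cons_val_one, two_nsmul_apply,
    Pi.add_apply, triE0_apply_zero, triE0_apply_one]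
  omega

/-- The vertical edge-midpoint `2x + e₁` is owned by `x`. [folklore] -/
@[simp] theorem cellDoubleOwner_two_nsmul_add_triE1 : cellDoubleOwner κ (2 • x + triE1) = x := by
  have h0 : (2 • x + triE1) 0 % 2 = 0 := by
    rw [Pi.add_apply, two_nsmul_apply, triE1_apply_zero]; omega
  rw [cellDoubleOwner, if_pos h0, half_two_nsmul_add_triE1]

/-- The face centre `2x + e₀ + e₁` is owned by `x` when `κ x = true`. [folklore] -/
theorem cellDoubleOwner_face_of_true (h : κ x = true) :
    cellDoubleOwner κ (2 • x + triE0 + triE1) = x := by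
  have h0 : ¬ (2 • x + triE0 + triE1) 0 % 2 = 0 := by
    rw [Pi.add_apply, Pi.add_apply, two_nsmul_apply, triE0_apply_zero, triE1_apply_zero]; omega
  have h1 : ¬ (2 • x + triE0 + triE1) 1 % 2 = 0 := by
    rw [Pi.add_apply, Pi.add_apply, two_nsmul_apply, triE0_apply_one, triE1_apply_one]; omega
  rw [cellDoubleOwner, if_neg h0, if_neg h1, half_two_nsmul_add_triE0_add_triE1, if_pos h]

/-- The face centre `2x + e₀ + e₁` is owned by `x + e₁` when `κ x = false`. [folklore] -/
theorem cellDoubleOwner_face_of_false (h : κ x = false) :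
    cellDoubleOwner κ (2 • x + triE0 + triE1) = x + triE1 := by
  have h0 : ¬ (2 • x + triE0 + triE1) 0 % 2 = 0 := by
    rw [Pi.add_apply, Pi.add_apply, two_nsmul_apply, triE0_apply_zero, triE1_apply_zero]; omega
  have h1 : ¬ (2 • x + triE0 + triE1) 1 % 2 = 0 := by
    rw [Pi.add_apply, Pi.add_apply, two_nsmul_apply, triE0_apply_one, triE1_apply_one]; omega
  have h' : ¬ κ x = true := by rw [h]; exact Bool.false_ne_true
  rw [cellDoubleOwner, if_neg h0, if_neg h1, half_two_nsmul_add_triE0_add_triE1, if_neg h',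
    funext_iff, Fin.forall_fin_two]
  simp only [Matrix.cons_val_zero, Matrix.cons_val_one, two_nsmul_apply,
    Pi.add_apply, triE0_apply_zero, triE0_apply_one, triE1_apply_zero, triE1_apply_one]
  omega

/-- Coordinate bounds of the owner cell: `⌊z₀/2⌋ ≤ o₀ ≤ ⌊(z₀+1)/2⌋`, `⌊z₁/2⌋ ≤ o₁ ≤ ⌊(z₁+1)/2⌋`.
[folklore] -/
theorem cellDoubleOwner_bounds (z : Site 2) :
    z 0 / 2 ≤ cellDoubleOwner κ z 0 ∧ cellDoubleOwner κ z 0 ≤ (z 0 + 1) / 2 ∧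
      z 1 / 2 ≤ cellDoubleOwner κ z 1 ∧ cellDoubleOwner κ z 1 ≤ (z 1 + 1) / 2 := by
  unfold cellDoubleOwner
  split_ifs <;>
    simp only [Matrix.cons_val_zero, Matrix.cons_val_one] <;> omega

/-- Every site of `ℤ²` is `2x`, `2x + e₀`, `2x + e₁` or `2x + e₀ + e₁` for some `x`. [folklore] -/
theorem exists_eq_two_nsmul_add (z : Site 2) :
    ∃ x : Site 2, z = 2 • x ∨ z = 2 • x + triE0 ∨ z = 2 • x + triE1 ∨ z = 2 • x + triE0 + triE1 := by
  refine ⟨![z 0 / 2, z 1 / 2], ?_⟩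
  simp only [funext_iff, Fin.forall_fin_two, Matrix.cons_val_zero, Matrix.cons_val_one,
    two_nsmul_apply, Pi.add_apply, triE0_apply_zero, triE0_apply_one, triE1_apply_zero,
    triE1_apply_one]
  omega

end Owner

/-! ### Owners of adjacent refined sites are equal or adjacent cells -/

section Geometry

variable (κ : Site 2 → Bool)

/-- `x ∼ x + e₀` in every triangulation `T_κ`. [folklore] -/
theorem cellGraph_adj_add_triE0 (x : Site 2) : (cellGraph κ).Adj x (x + triE0) :=
  zdGraph_le_cellGraph κ ((zdGraph_adj_iff _ _).2 ⟨0, Or.inl rfl⟩)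

/-- `x ∼ x + e₁` in every triangulation `T_κ`. [folklore] -/
theorem cellGraph_adj_add_triE1 (x : Site 2) : (cellGraph κ).Adj x (x + triE1) :=
  zdGraph_le_cellGraph κ ((zdGraph_adj_iff _ _).2 ⟨1, Or.inl rfl⟩)

/-- The NE–SW diagonal `x ∼ x + e₀ + e₁` of the face `x` when `κ x = true`. [folklore] -/
theorem cellGraph_adj_diag_of_true {x : Site 2} (h : κ x = true) :
    (cellGraph κ).Adj x (x + triE0 + triE1) := by
  have e : x + triE0 + triE1 = x + 1 := by
    rw [funext_iff, Fin.forall_fin_two]; constructor <;> simp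
  rw [e]
  exact (cellGraph_adj_diag_iff κ x).2 h

/-- The NW–SE diagonal `x + e₁ ∼ x + e₀` of the face `x` when `κ x = false`. [folklore] -/
theorem cellGraph_adj_antidiag_of_false {x : Site 2} (h : κ x = false) :
    (cellGraph κ).Adj (x + triE1) (x + triE0) :=
  (cellGraph_adj_antidiag_iff κ x).2 h

/-- **Owners of adjacent refined sites, forward directions.** If `z' = z + e₀`, `z + e₁` or
`z + (1,-1)` then the owner cells of `z` and `z'` are equal or adjacent in the triangulation
`T_κ` (twelve cases: four residues of `z` times three directions). [folklore] -/
theorem cellDoubleOwner_rel_aux {z z' : Site 2}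
    (hd : z' = z + triE0 ∨ z' = z + triE1 ∨ z' = z + triDiag) :
    cellDoubleOwner κ z = cellDoubleOwner κ z' ∨
      (cellGraph κ).Adj (cellDoubleOwner κ z) (cellDoubleOwner κ z') := by
  obtain ⟨x, rfl | rfl | rfl | rfl⟩ := exists_eq_two_nsmul_add z <;>
    rcases hd with rfl | rfl | rfl
  · -- cell `2x`, direction `e₀`: owners `x`, `x + e₀`
    right
    rw [cellDoubleOwner_two_nsmul, cellDoubleOwner_two_nsmul_add_triE0]
    exact cellGraph_adj_add_triE0 κ x
  · -- cell `2x`, direction `e₁`: owners `x`, `x`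
    left
    rw [cellDoubleOwner_two_nsmul, cellDoubleOwner_two_nsmul_add_triE1]
  · -- cell `2x`, direction `(1,-1)`: the face centre of the face `x - e₁`
    have e : 2 • x + triDiag = 2 • (x - triE1) + triE0 + triE1 := by
      rw [funext_iff, Fin.forall_fin_two]; constructor <;> simp; omega
    rw [e, cellDoubleOwner_two_nsmul]
    cases h : κ (x - triE1)
    · left
      rw [cellDoubleOwner_face_of_false _ _ h, sub_add_cancel]
    · right
      rw [cellDoubleOwner_face_of_true _ _ h]
      have := cellGraph_adj_add_triE1 κ (x - triE1)
      rw [sub_add_cancel] at this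
      exact this.symm
  · -- midpoint `2x + e₀`, direction `e₀`: the cell `2(x + e₀)`
    have e : 2 • x + triE0 + triE0 = 2 • (x + triE0) := by
      rw [funext_iff, Fin.forall_fin_two]; constructor <;> simp; omega
    left
    rw [e, cellDoubleOwner_two_nsmul_add_triE0, cellDoubleOwner_two_nsmul]
  · -- midpoint `2x + e₀`, direction `e₁`: the face centre of the face `x`
    rw [cellDoubleOwner_two_nsmul_add_triE0]
    cases h : κ x
    · right
      rw [cellDoubleOwner_face_of_false _ _ h]
      exact (cellGraph_adj_antidiag_of_false κ h).symm
    · right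
      rw [cellDoubleOwner_face_of_true _ _ h]
      exact (cellGraph_adj_add_triE0 κ x).symm
  · -- midpoint `2x + e₀`, direction `(1,-1)`: the midpoint `2(x + e₀ - e₁) + e₁`
    have e : 2 • x + triE0 + triDiag = 2 • (x + triE0 - triE1) + triE1 := by
      rw [funext_iff, Fin.forall_fin_two]; constructor <;> simp <;> omega
    right
    rw [e, cellDoubleOwner_two_nsmul_add_triE0, cellDoubleOwner_two_nsmul_add_triE1]
    have := cellGraph_adj_add_triE1 κ (x + triE0 - triE1)
    rw [sub_add_cancel] at this
    exact this.symm
  · -- midpoint `2x + e₁`, direction `e₀`: the face centre of the face `x`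
    rw [add_right_comm, cellDoubleOwner_two_nsmul_add_triE1]
    cases h : κ x
    · right
      rw [cellDoubleOwner_face_of_false _ _ h]
      exact cellGraph_adj_add_triE1 κ x
    · left
      rw [cellDoubleOwner_face_of_true _ _ h]
  · -- midpoint `2x + e₁`, direction `e₁`: the cell `2(x + e₁)`
    have e : 2 • x + triE1 + triE1 = 2 • (x + triE1) := by
      rw [funext_iff, Fin.forall_fin_two]; constructor <;> simp; omega
    right
    rw [e, cellDoubleOwner_two_nsmul_add_triE1, cellDoubleOwner_two_nsmul]
    exact cellGraph_adj_add_triE1 κ x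
  · -- midpoint `2x + e₁`, direction `(1,-1)`: the midpoint `2x + e₀`
    have e : 2 • x + triE1 + triDiag = 2 • x + triE0 := by
      rw [funext_iff, Fin.forall_fin_two]; constructor <;> simp
    right
    rw [e, cellDoubleOwner_two_nsmul_add_triE1, cellDoubleOwner_two_nsmul_add_triE0]
    exact cellGraph_adj_add_triE0 κ x
  · -- face centre `2x + e₀ + e₁`, direction `e₀`: the midpoint `2(x + e₀) + e₁`
    have e : 2 • x + triE0 + triE1 + triE0 = 2 • (x + triE0) + triE1 := by
      rw [funext_iff, Fin.forall_fin_two]; constructor <;> simp; omega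
    rw [e, cellDoubleOwner_two_nsmul_add_triE1]
    cases h : κ x
    · right
      rw [cellDoubleOwner_face_of_false _ _ h]
      exact cellGraph_adj_antidiag_of_false κ h
    · right
      rw [cellDoubleOwner_face_of_true _ _ h]
      exact cellGraph_adj_add_triE0 κ x
  · -- face centre `2x + e₀ + e₁`, direction `e₁`: the midpoint `2(x + e₁) + e₀`
    have e : 2 • x + triE0 + triE1 + triE1 = 2 • (x + triE1) + triE0 := by
      rw [funext_iff, Fin.forall_fin_two]; constructor <;> simp; omega
    rw [e, cellDoubleOwner_two_nsmul_add_triE0]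
    cases h : κ x
    · right
      rw [cellDoubleOwner_face_of_false _ _ h]
      exact cellGraph_adj_add_triE0 κ (x + triE1)
    · right
      rw [cellDoubleOwner_face_of_true _ _ h, add_right_comm]
      exact cellGraph_adj_diag_of_true κ h
  · -- face centre `2x + e₀ + e₁`, direction `(1,-1)`: the cell `2(x + e₀)`
    have e : 2 • x + triE0 + triE1 + triDiag = 2 • (x + triE0) := by
      rw [funext_iff, Fin.forall_fin_two]; constructor <;> simp; omega
    rw [e, cellDoubleOwner_two_nsmul]
    cases h : κ x
    · right
      rw [cellDoubleOwner_face_of_false _ _ h]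
      exact cellGraph_adj_antidiag_of_false κ h
    · right
      rw [cellDoubleOwner_face_of_true _ _ h]
      exact cellGraph_adj_add_triE0 κ x

/-- **Owners of adjacent refined sites are equal or adjacent**: for `z ∼ z'` in the triangular
lattice `𝕋`, the owner cells of `z` and `z'` coincide or are adjacent in `T_κ`. This is the whole
geometric content of the embedding. [folklore] -/
theorem cellDoubleOwner_rel {z z' : Site 2} (h : triGraph.Adj z z') :
    cellDoubleOwner κ z = cellDoubleOwner κ z' ∨
      (cellGraph κ).Adj (cellDoubleOwner κ z) (cellDoubleOwner κ z') := by
  rcases (triGraph_adj_iff z z').1 h with h | h | h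
  · obtain ⟨i, h | h⟩ := (zdGraph_adj_iff z z').1 h
    · fin_cases i
      · exact cellDoubleOwner_rel_aux κ (Or.inl h)
      · exact cellDoubleOwner_rel_aux κ (Or.inr (Or.inl h))
    · fin_cases i
      · exact (cellDoubleOwner_rel_aux κ (Or.inl h)).imp Eq.symm SimpleGraph.Adj.symm
      · exact (cellDoubleOwner_rel_aux κ (Or.inr (Or.inl h))).imp Eq.symm SimpleGraph.Adj.symm
  · exact cellDoubleOwner_rel_aux κ (Or.inr (Or.inr h))
  · exact (cellDoubleOwner_rel_aux κ (Or.inr (Or.inr h))).imp Eq.symm SimpleGraph.Adj.symm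

end Geometry

/-! ### Rectangles: the doubled box `[0, 2m] × [0, 2n]` -/

section Rectangles

variable (κ : Site 2 → Bool) {m n : ℕ}

/-- Membership in the doubled box, in coordinates. [folklore] -/
theorem mem_coe_rectangle_two_mul_iff {z : Site 2} :
    z ∈ (↑(rectangle (2 * m) (2 * n)) : Set (Site 2)) ↔
      0 ≤ z 0 ∧ z 0 ≤ 2 * m ∧ 0 ≤ z 1 ∧ z 1 ≤ 2 * n := by
  rw [Finset.mem_coe, mem_rectangle_iff]; push_cast; exact Iff.rfl

/-- Membership in the box, in coordinates (coercion form). [folklore] -/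
theorem mem_coe_rectangle_iff' {z : Site 2} :
    z ∈ (↑(rectangle m n) : Set (Site 2)) ↔ 0 ≤ z 0 ∧ z 0 ≤ m ∧ 0 ≤ z 1 ∧ z 1 ≤ n := by
  rw [Finset.mem_coe, mem_rectangle_iff]

/-- The owner of a site of the doubled box is a cell of the box. [folklore] -/
theorem cellDoubleOwner_mem_rectangle {z : Site 2}
    (hz : z ∈ (↑(rectangle (2 * m) (2 * n)) : Set (Site 2))) :
    cellDoubleOwner κ z ∈ (↑(rectangle m n) : Set (Site 2)) := by
  rw [mem_coe_rectangle_two_mul_iff] at hz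
  rw [mem_coe_rectangle_iff']
  have hb := cellDoubleOwner_bounds κ z
  omega

/-- The owner map sends each side of the doubled box to the corresponding side of the box
(`o₀ ∈ [⌊z₀/2⌋, ⌊(z₀+1)/2⌋]`, `o₁ ∈ [⌊z₁/2⌋, ⌊(z₁+1)/2⌋]`). [folklore] -/
theorem cellDoubleOwner_mem_sides (z : Site 2) :
    (z ∈ leftSide (2 * m) (2 * n) → cellDoubleOwner κ z ∈ leftSide m n) ∧
      (z ∈ rightSide (2 * m) (2 * n) → cellDoubleOwner κ z ∈ rightSide m n) ∧
      (z ∈ bottomSide (2 * m) (2 * n) → cellDoubleOwner κ z ∈ bottomSide m n) ∧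
      (z ∈ topSide (2 * m) (2 * n) → cellDoubleOwner κ z ∈ topSide m n) := by
  have hb := cellDoubleOwner_bounds κ z
  simp only [leftSide, rightSide, bottomSide, topSide, Finset.mem_filter, mem_rectangle_iff]
  push_cast
  omega

/-- Doubling `x ↦ 2x` sends each side of the box to the corresponding side of the doubled box.
[folklore] -/
theorem two_nsmul_mem_sides (x : Site 2) :
    (x ∈ leftSide m n → 2 • x ∈ leftSide (2 * m) (2 * n)) ∧
      (x ∈ rightSide m n → 2 • x ∈ rightSide (2 * m) (2 * n)) ∧
      (x ∈ bottomSide m n → 2 • x ∈ bottomSide (2 * m) (2 * n)) ∧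
      (x ∈ topSide m n → 2 • x ∈ topSide (2 * m) (2 * n)) := by
  simp only [leftSide, rightSide, bottomSide, topSide, Finset.mem_filter, mem_rectangle_iff,
    two_nsmul_apply]
  push_cast
  omega

end Rectangles

/-! ### Projecting paths of the triangular lattice to paths of cells -/

/-- **Projection.** A `𝕋`-path inside the doubled box all of whose sites have black owners
projects, owner by owner, to a path of black cells of the box in the black graph of `ω`
(`cellDoubleOwner_rel`: consecutive owners are equal or adjacent in `T_κ`). [folklore] -/
theorem pathIn_cellDoubleOwner {m n : ℕ} (ω : CellConfig) {u v : Site 2}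
    (h : PathIn triGraph
      (↑(rectangle (2 * m) (2 * n)) ∩ cellDoubleOwner ω.2 ⁻¹' ω.black) u v) :
    PathIn (cellGraph ω.2) (↑(rectangle m n) ∩ ω.black)
      (cellDoubleOwner ω.2 u) (cellDoubleOwner ω.2 v) := by
  obtain ⟨hu, h⟩ := h
  induction h with
  | refl => exact PathIn.refl ⟨cellDoubleOwner_mem_rectangle ω.2 hu.1, hu.2⟩
  | @tail b c _ hbc ih =>
    exact ih.trans (PathIn.of_eq_or_adj ih.right_mem
      ⟨cellDoubleOwner_mem_rectangle ω.2 hbc.2.1, hbc.2.2⟩ (cellDoubleOwner_rel ω.2 hbc.1))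

/-! ### Lifting paths of cells to paths of the triangular lattice -/

/-- **Lift, forward directions.** For black cells `x`, `y` of the box with `y = x + e₀`,
`y = x + e₁`, or `{x, y}` the coin-selected diagonal of a face written from `x`
(`cellDiagRel`), there is a `𝕋`-path inside the doubled box, through refined sites with black
owners, from `2x` to `2y`: through the midpoint `2x + e₀`, resp. `2x + e₁`, resp. (diagonal
`y = x + (1,1)`, `κ x = true`) `2x + e₁, 2x + e₀ + e₁, 2x + e₀ + 2e₁`, resp. (diagonal
`y = x + (1,-1)`, `κ (x - e₁) = false`) the face centre `2x + (1,-1)`. [folklore] -/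
theorem pathIn_two_nsmul_aux {m n : ℕ} (ω : CellConfig) {x y : Site 2}
    (hx : x ∈ (↑(rectangle m n) : Set (Site 2)) ∩ ω.black)
    (hy : y ∈ (↑(rectangle m n) : Set (Site 2)) ∩ ω.black)
    (hd : y = x + triE0 ∨ y = x + triE1 ∨ cellDiagRel ω.2 x y) :
    PathIn triGraph (↑(rectangle (2 * m) (2 * n)) ∩ cellDoubleOwner ω.2 ⁻¹' ω.black)
      (2 • x) (2 • y) := by
  set A : Set (Site 2) := ↑(rectangle (2 * m) (2 * n)) ∩ cellDoubleOwner ω.2 ⁻¹' ω.black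
  have hxR := mem_coe_rectangle_iff'.1 hx.1
  have hyR := mem_coe_rectangle_iff'.1 hy.1
  have hxB : ω.1 x = true := hx.2
  have hyB : ω.1 y = true := hy.2
  -- membership in `A`: coordinates in the doubled box and a black owner
  have mem : ∀ {z : Site 2}, 0 ≤ z 0 → z 0 ≤ 2 * m → 0 ≤ z 1 → z 1 ≤ 2 * n →
      ω.1 (cellDoubleOwner ω.2 z) = true → z ∈ A :=
    fun h0 h0' h1 h1' hB => ⟨mem_coe_rectangle_two_mul_iff.2 ⟨h0, h0', h1, h1'⟩, hB⟩
  have h2x : 2 • x ∈ A :=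
    mem (by rw [two_nsmul_apply]; omega) (by rw [two_nsmul_apply]; omega)
      (by rw [two_nsmul_apply]; omega) (by rw [two_nsmul_apply]; omega)
      (by rw [cellDoubleOwner_two_nsmul]; exact hxB)
  rcases hd with rfl | rfl | ⟨hk, rfl⟩ | ⟨hk, rfl⟩
  · -- `y = x + e₀`, through the midpoint `2x + e₀`
    simp only [Pi.add_apply, triE0_apply_zero, triE0_apply_one] at hyR
    have e : 2 • (x + triE0) = 2 • x + triE0 + triE0 := by
      rw [funext_iff, Fin.forall_fin_two]; constructor <;> simp; omega
    have h1 : 2 • x + triE0 ∈ A := mem (by simp; omega) (by simp; omega) (by simp; omega)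
      (by simp; omega) (by rw [cellDoubleOwner_two_nsmul_add_triE0]; exact hyB)
    have h2 : 2 • (x + triE0) ∈ A := mem (by simp; omega) (by simp; omega) (by simp; omega)
      (by simp; omega) (by rw [cellDoubleOwner_two_nsmul]; exact hyB)
    refine (PathIn.of_adj h2x h1 (triGraph_adj_add_triE0 _)).tail ?_ h2
    rw [e]; exact triGraph_adj_add_triE0 _
  · -- `y = x + e₁`, through the midpoint `2x + e₁`
    simp only [Pi.add_apply, triE1_apply_zero, triE1_apply_one] at hyR
    have e : 2 • (x + triE1) = 2 • x + triE1 + triE1 := by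
      rw [funext_iff, Fin.forall_fin_two]; constructor <;> simp; omega
    have h1 : 2 • x + triE1 ∈ A := mem (by simp; omega) (by simp; omega) (by simp; omega)
      (by simp; omega) (by rw [cellDoubleOwner_two_nsmul_add_triE1]; exact hxB)
    have h2 : 2 • (x + triE1) ∈ A := mem (by simp; omega) (by simp; omega) (by simp; omega)
      (by simp; omega) (by rw [cellDoubleOwner_two_nsmul]; exact hyB)
    refine (PathIn.of_adj h2x h1 (triGraph_adj_add_triE1 _)).tail ?_ h2
    rw [e]; exact triGraph_adj_add_triE1 _
  · -- `y = x + (1,1)` with `κ x = true`, through `2x + e₁`, `2x + e₀ + e₁`, `2x + e₀ + 2e₁`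
    simp only [Pi.add_apply, Pi.one_apply] at hyR
    have ey : x + 1 = x + triE1 + triE0 := by
      rw [funext_iff, Fin.forall_fin_two]; constructor <;> simp
    have e2 : 2 • x + triE0 + triE1 = 2 • x + triE1 + triE0 := add_right_comm _ _ _
    have e3 : 2 • (x + triE1) + triE0 = 2 • x + triE0 + triE1 + triE1 := by
      rw [funext_iff, Fin.forall_fin_two]; constructor <;> simp; omega
    have e4 : 2 • (x + 1) = 2 • (x + triE1) + triE0 + triE0 := by
      rw [funext_iff, Fin.forall_fin_two]; constructor <;> simp <;> omega
    have h1 : 2 • x + triE1 ∈ A := mem (by simp; omega) (by simp; omega) (by simp; omega)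
      (by simp; omega) (by rw [cellDoubleOwner_two_nsmul_add_triE1]; exact hxB)
    have h2 : 2 • x + triE0 + triE1 ∈ A := mem (by simp; omega) (by simp; omega)
      (by simp; omega) (by simp; omega) (by rw [cellDoubleOwner_face_of_true _ _ hk]; exact hxB)
    have h3 : 2 • (x + triE1) + triE0 ∈ A := mem (by simp; omega) (by simp; omega)
      (by simp; omega) (by simp; omega)
      (by rw [cellDoubleOwner_two_nsmul_add_triE0, ← ey]; exact hyB)
    have h4 : 2 • (x + 1) ∈ A := mem (by simp; omega) (by simp; omega) (by simp; omega)
      (by simp; omega) (by rw [cellDoubleOwner_two_nsmul]; exact hyB)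
    refine (((PathIn.of_adj h2x h1 (triGraph_adj_add_triE1 _)).tail ?_ h2).tail ?_ h3).tail ?_ h4
    · rw [e2]; exact triGraph_adj_add_triE0 _
    · rw [e3]; exact triGraph_adj_add_triE1 _
    · rw [e4]; exact triGraph_adj_add_triE0 _
  · -- `y = x + (1,-1)` with `κ (x - e₁) = false`, through the face centre `2x + (1,-1)`
    simp only [Pi.add_apply, triDiag_zero, triDiag_one] at hyR
    have e1 : 2 • x + triDiag = 2 • (x - triE1) + triE0 + triE1 := by
      rw [funext_iff, Fin.forall_fin_two]; constructor <;> simp; omega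
    have e2 : 2 • (x + triDiag) = 2 • x + triDiag + triDiag := by
      rw [funext_iff, Fin.forall_fin_two]; constructor <;> simp <;> omega
    have h1 : 2 • x + triDiag ∈ A := mem (by simp; omega) (by simp; omega) (by simp; omega)
      (by simp; omega) (by rw [e1, cellDoubleOwner_face_of_false _ _ hk, sub_add_cancel]; exact hxB)
    have h2 : 2 • (x + triDiag) ∈ A := mem (by simp; omega) (by simp; omega) (by simp; omega)
      (by simp; omega) (by rw [cellDoubleOwner_two_nsmul]; exact hyB)
    refine (PathIn.of_adj h2x h1 (triGraph_adj_add_triDiag _)).tail ?_ h2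
    rw [e2]; exact triGraph_adj_add_triDiag _

/-- **Lift of one edge.** Adjacent black cells of the box are joined, after doubling, by a
`𝕋`-path inside the doubled box through refined sites with black owners. [folklore] -/
theorem pathIn_two_nsmul_of_adj {m n : ℕ} (ω : CellConfig) {x y : Site 2}
    (hx : x ∈ (↑(rectangle m n) : Set (Site 2)) ∩ ω.black)
    (hy : y ∈ (↑(rectangle m n) : Set (Site 2)) ∩ ω.black) (h : (cellGraph ω.2).Adj x y) :
    PathIn triGraph (↑(rectangle (2 * m) (2 * n)) ∩ cellDoubleOwner ω.2 ⁻¹' ω.black)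
      (2 • x) (2 • y) := by
  rcases cellGraph_adj_iff.1 h with h | h | h
  · obtain ⟨i, h | h⟩ := (zdGraph_adj_iff x y).1 h
    · fin_cases i
      · exact pathIn_two_nsmul_aux ω hx hy (Or.inl h)
      · exact pathIn_two_nsmul_aux ω hx hy (Or.inr (Or.inl h))
    · fin_cases i
      · exact (pathIn_two_nsmul_aux ω hy hx (Or.inl h)).symm
      · exact (pathIn_two_nsmul_aux ω hy hx (Or.inr (Or.inl h))).symm
  · exact pathIn_two_nsmul_aux ω hx hy (Or.inr (Or.inr h))
  · exact (pathIn_two_nsmul_aux ω hy hx (Or.inr (Or.inr h))).symm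

/-- **Lift.** A path of black cells of the box in the black graph of `ω` lifts to a `𝕋`-path
inside the doubled box through refined sites with black owners. [folklore] -/
theorem pathIn_two_nsmul {m n : ℕ} (ω : CellConfig) {u v : Site 2}
    (h : PathIn (cellGraph ω.2) (↑(rectangle m n) ∩ ω.black) u v) :
    PathIn triGraph (↑(rectangle (2 * m) (2 * n)) ∩ cellDoubleOwner ω.2 ⁻¹' ω.black)
      (2 • u) (2 • v) := by
  obtain ⟨hu, h⟩ := h
  induction h with
  | refl =>
    refine PathIn.refl ⟨?_, ?_⟩
    · have huR := mem_coe_rectangle_iff'.1 hu.1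
      rw [mem_coe_rectangle_two_mul_iff, two_nsmul_apply, two_nsmul_apply]
      omega
    · show cellDoubleOwner ω.2 (2 • u) ∈ ω.black
      rw [cellDoubleOwner_two_nsmul]; exact hu.2
  | @tail b c hub hbc ih =>
    exact ih.trans (pathIn_two_nsmul_of_adj ω (PathIn.right_mem ⟨hu, hub⟩) hbc.2 hbc.1)

/-! ### The Hex lemma for the cell grid -/

/-- The refined colouring is colour-swap equivariant: the sites with white owners are the sites
with black owners for the swapped configuration (the owner map depends on the coins only).
[folklore] -/
theorem compl_preimage_cellDoubleOwner_black (ω : CellConfig) :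
    (cellDoubleOwner ω.2 ⁻¹' ω.black)ᶜ = cellDoubleOwner ω.swap.2 ⁻¹' ω.swap.black := by
  rw [CellConfig.swap_snd, CellConfig.black_swap, CellConfig.white_eq_compl_black,
    Set.preimage_compl]

/-- **The Hex lemma / self-duality of the cell grid holds** (the named fact
`cellCrossing_duality`; Kesten 1982, Prop. 2.2 with §2.2 Ex. (iii); Gale 1979, Hex theorem):
for every colouring, every choice of coins and every box `[0, m] × [0, n]`, exactly one of "black
left–right crossing in `blackGraph`", "white top–bottom crossing in `whiteGraph`" occurs.
Proof: by the doubling map, existence is the existence half `tri_hex` of the Hex lemma on the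
triangular lattice for the doubled box and the colouring "colour of the owner", projected back
(`pathIn_cellDoubleOwner`), and exclusivity is its exclusivity half `tri_hex_excl` applied to
the lifts (`pathIn_two_nsmul`) of the two crossings. (The hypothesis `1 ≤ n` of the fact is not
needed.) [cite: Kesten1982, Prop. 2.2 and §2.2 Ex. (iii)] -/
theorem cellCrossing_duality_holds : cellCrossing_duality := by
  intro m n _ ω
  have hcompl := compl_preimage_cellDoubleOwner_black ω
  -- existence: at least one of the two crossings
  have hex : ω ∈ cellLRCrossing m n ∨ ω ∈ cellTBCrossingWhite m n := by
    rcases tri_hex (2 * m) (2 * n) (cellDoubleOwner ω.2 ⁻¹' ω.black) with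
      ⟨u, hu, v, hv, huv⟩ | ⟨u, hu, v, hv, huv⟩
    · refine Or.inl ⟨_, (cellDoubleOwner_mem_sides ω.2 u).1 hu, _,
        (cellDoubleOwner_mem_sides ω.2 v).2.1 hv, ?_⟩
      exact mem_cellConnIn_iff_pathIn.2 (pathIn_cellDoubleOwner ω huv)
    · refine Or.inr ⟨_, (cellDoubleOwner_mem_sides ω.2 u).2.2.1 hu, _,
        (cellDoubleOwner_mem_sides ω.2 v).2.2.2 hv, ?_⟩
      rw [hcompl] at huv
      exact mem_cellConnIn_iff_pathIn.2 (pathIn_cellDoubleOwner ω.swap huv)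
  -- exclusivity: not both
  have hexcl : ¬ (ω ∈ cellLRCrossing m n ∧ ω ∈ cellTBCrossingWhite m n) := by
    rintro ⟨⟨x, hx, y, hy, hxy⟩, ⟨u, hu, v, hv, huv⟩⟩
    rw [mem_cellConnIn_iff_pathIn] at hxy huv
    have h1 := pathIn_two_nsmul ω hxy
    have h2 := pathIn_two_nsmul ω.swap huv
    rw [← hcompl] at h2
    exact tri_hex_excl (2 * m) (2 * n) _ ((two_nsmul_mem_sides x).1 hx)
      ((two_nsmul_mem_sides y).2.1 hy) h1 ((two_nsmul_mem_sides u).2.2.1 hu)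
      ((two_nsmul_mem_sides v).2.2.2 hv) h2
  rcases hex with h | h
  · exact Or.inl ⟨h, fun h' => hexcl ⟨h, h'⟩⟩
  · exact Or.inr ⟨h, fun h' => hexcl ⟨h', h⟩⟩

end Literature.Probability.LatticeModels
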